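import Literature.Geometry.Lorentzian.KerrTortoiseZones
import Literature.Analysis.ODE.SoninEnvelope
import HarnessLib

/-!
# Far-zone a-priori envelope for the infinity-normalised solution of Carter's equation (tortoise form)
(namespace `Literature.Geometry.Lorentzian.Kerr`.)

Carter's radial equation of the separated wave equation on Kerr reads, in the tortoise variable,
`u″ + (ω² − V(ρ x)) u = 0` with `V = Kerr.sepPotential M a ω m Λ` and `ρ` a tortoise radius function
(Dafermos–Rodnianski–Shlapentokh-Rothman, arXiv:1402.7034, §5.2.3). For a solution with the data of the
solution normalised at `𝓘⁺` — `‖u‖ → 1`, `‖u′‖ → |ω|` as `x → +∞` — the Sonin energy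
`T = (ω² − V)‖u‖² + ‖u′‖²` is NON-DECREASING along `r*` on the region `r ≥ 7M` where `dV/dr < 0`
(DRSR §8.4, (decrease)), and `T → 2ω²`; hence on `ρ x ≥ 7M`:

* `carter_farEnergy_le` — `(ω² − V(ρ x))‖u x‖² + ‖u′ x‖² ≤ 2ω²`;
* `carter_far_norm_deriv_le` — `‖u′ x‖ ≤ √2·|ω|` wherever moreover `ω² − V(ρ x) ≥ 0`;
* `carter_far_norm_le_two` — `‖u x‖ ≤ 2` for `ρ x ≥ R_far := max(7M, √(12Λ)/|ω|, 1/(Mω²))`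
  (`ω² − V ≥ ω²/2` there);
* `carter_far_norm_le_linear` — LINEAR growth inward: `‖u x‖ ≤ ‖u y‖ + √2|ω|(y − x)` for `x ≤ y`,
  `ρ x ≥ 7M`, `ω² − V ∘ ρ ≥ 0` on `[x, y]`;
* `carter_far_norm_le` — consequently `‖u x‖ ≤ 2 + 2|ω|·R_far` at every `x` with `ρ x ≥ 7M` beyond
  which the coefficient stays non-negative (no transition collar is needed in the far zone, which is why
  the resulting kernel bounds are polynomial in `Λ`: `R_far ≍ √Λ/|ω|`).

This is the tortoise-language twin of `TeukolskyFarEnvelope.lean` (stated there for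
`u = (r² + a²)^{1/2} R_{𝓘⁺}` in the `r`-variable); here the solution is any `u` with the stated end data,
which is the form consumed by the flux-regime cone kernel bound.

## References
* M. Dafermos, I. Rodnianski, Y. Shlapentokh-Rothman, arXiv:1402.7034 = Ann. of Math. 183 (2016),
  §5.2.3, §8.4 (Prop. 8.4.1, (someBoundS), (decrease)); key `DafermosRodnianskiShlapentokhrothman2014`.
* G. Szegő, *Orthogonal Polynomials*, §7.31 (Sonin's monotonicity theorem).
-/

noncomputable section

open Filter Set
open scoped _root_.Topology

namespace Literature.Geometry.Lorentzian

namespace Kerr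

/-! ### The far region `r ≥ max(7M, √(12Λ)/|ω|, 1/(Mω²))` -/

-- adapted from Literature/Geometry/Lorentzian/TeukolskyFarEnvelope.lean (private `far_region` there)
/-- On `t ≥ max(7M, √(12Λ)/|ω|, 1/(Mω²))` (`|a| < M`, `ω ≠ 0`, admissible triple): `ω² − V(t) ≥ ω²/2`
(from `|V| ≤ 3Λ/t² + 3M/t³`, `Kerr.abs_sepPotential_le`, with `t²ω² ≥ 12Λ` and `t³ω² ≥ 49M ≥ 12M`).
DRSR arXiv:1402.7034, §8.4 (someBoundS). [cite: DafermosRodnianskiShlapentokhrothman2014, Prop. 8.4.1 (proof)] -/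
theorem half_sq_le_omega_sq_sub_sepPotential {M a ω Λ : ℝ} {m : ℤ} (hMa : IsSubextremal M a) (hω : ω ≠ 0)
    (hadm : IsAdmissibleTriple a ω m Λ) {t : ℝ}
    (ht : max (7 * M) (max (Real.sqrt (12 * Λ) / |ω|) (1 / (M * ω ^ 2))) ≤ t) :
    ω ^ 2 / 2 ≤ ω ^ 2 - sepPotential M a ω m Λ t := by
  have hM : 0 < M := hMa.pos
  have ha : |a| < M := hMa
  have h7 : 7 * M ≤ t := le_of_max_le_left ht
  have hΛt : Real.sqrt (12 * Λ) / |ω| ≤ t := le_of_max_le_left (le_of_max_le_right ht)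
  have hMt : 1 / (M * ω ^ 2) ≤ t := le_of_max_le_right (le_of_max_le_right ht)
  have ht0 : 0 < t := by linarith
  have hω0 : 0 < |ω| := abs_pos.2 hω
  have hω2 : 0 < ω ^ 2 := by positivity
  have hrp : rPlus M a < t := by
    have h1 : Real.sqrt (M ^ 2 - a ^ 2) ≤ M := by
      rw [Real.sqrt_le_left hM.le]
      nlinarith [sq_nonneg a]
    unfold rPlus
    linarith
  have hΛ : 0 ≤ Λ := hadm.nonneg
  have h1 : Real.sqrt (12 * Λ) ≤ t * |ω| := by rwa [div_le_iff₀ hω0] at hΛt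
  have h2 : 12 * Λ ≤ t ^ 2 * ω ^ 2 := by
    have h3 : Real.sqrt (12 * Λ) ^ 2 ≤ (t * |ω|) ^ 2 :=
      pow_le_pow_left₀ (Real.sqrt_nonneg _) h1 2
    rwa [Real.sq_sqrt (by positivity), mul_pow, sq_abs] at h3
  have hA : 3 * Λ / t ^ 2 ≤ ω ^ 2 / 4 := by
    rw [div_le_iff₀ (by positivity)]
    linarith
  have h4 : 1 ≤ t * (M * ω ^ 2) := by rwa [div_le_iff₀ (by positivity)] at hMt
  have h5 : 49 * M ≤ ω ^ 2 * t ^ 3 := by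
    have h6 : M * (49 * M) ≤ M * (ω ^ 2 * t ^ 3) := by
      have h7' : 49 * M ^ 2 ≤ t ^ 2 := by nlinarith
      have h8 : t ^ 2 * 1 ≤ t ^ 2 * (t * (M * ω ^ 2)) :=
        mul_le_mul_of_nonneg_left h4 (sq_nonneg t)
      nlinarith
    exact le_of_mul_le_mul_left h6 hM
  have hB : 3 * M / t ^ 3 ≤ ω ^ 2 / 4 := by
    rw [div_le_iff₀ (by positivity)]
    nlinarith
  have hV := (le_abs_self _).trans (abs_sepPotential_le hM ha.le hadm hrp.le)
  linarith

/-- `V(ρ x) → 0` as `x → +∞` along a tortoise radius function (`|V| ≤ 3Λ/r² + 3M/r³` on `r ≥ r₊` and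
`ρ → ∞`). DRSR arXiv:1402.7034, §8.4 (someBoundS). [cite: DafermosRodnianskiShlapentokhrothman2014, §8.4] -/
theorem IsTortoiseRadius.tendsto_sepPotential_atTop {M a ω Λ : ℝ} {m : ℤ} {ρ : ℝ → ℝ}
    (hρ : IsTortoiseRadius M a ρ) (hMa : IsSubextremal M a) (hadm : IsAdmissibleTriple a ω m Λ) :
    Tendsto (fun x ↦ sepPotential M a ω m Λ (ρ x)) atTop (𝓝 0) := by
  have hM : 0 < M := hMa.pos
  have hb : Tendsto (fun x ↦ 3 * Λ / ρ x ^ 2 + 3 * M / ρ x ^ 3) atTop (𝓝 0) := by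
    have h2 := (tendsto_pow_atTop two_ne_zero).comp hρ.tendsto_atTop
    have h3 := (tendsto_pow_atTop three_ne_zero).comp hρ.tendsto_atTop
    have h := ((tendsto_const_nhds (x := 3 * Λ)).div_atTop h2).add
      ((tendsto_const_nhds (x := 3 * M)).div_atTop h3)
    rw [add_zero] at h
    exact h
  refine squeeze_zero_norm (fun x ↦ ?_) hb
  rw [Real.norm_eq_abs]
  exact abs_sepPotential_le hM (le_of_lt hMa) hadm (hρ.rPlus_lt x).le

/-! ### The Sonin energy of a solution with `𝓘⁺` data is at most `2ω²` on `ρ ≥ 7M` -/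

section Far

variable {M a ω Λ : ℝ} {m : ℤ} {ρ : ℝ → ℝ} {u u₁ : ℝ → ℂ}

/-- **Far Sonin-energy bound (tortoise form).** Let `u″ + (ω² − V(ρ x))u = 0` along a tortoise radius
`ρ` (`|a| < M`, admissible `(ω, m, Λ)`), with `‖u‖ → 1` and `‖u′‖ → |ω|` at `+∞`. Then for every `x` with
`ρ x ≥ 7M`: `(ω² − V(ρ x))‖u x‖² + ‖u′ x‖² ≤ 2ω²` — the Sonin energy is non-decreasing on `[x, ∞)`
(`dV/dr < 0` for `r ≥ 7M`, `Kerr.deriv_sepPotential_neg_of_seven_mul_le`, and `dρ/dx > 0`) and tends to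
`ω²·1 + ω²`. DRSR arXiv:1402.7034, §8.4. [cite: DafermosRodnianskiShlapentokhrothman2014, Prop. 8.4.1 (proof)] -/
theorem carter_farEnergy_le (hρ : IsTortoiseRadius M a ρ) (hMa : IsSubextremal M a)
    (hadm : IsAdmissibleTriple a ω m Λ)
    (hu : ∀ x, HasDerivAt u (u₁ x) x ∧
      HasDerivAt u₁ (-(((ω ^ 2 - sepPotential M a ω m Λ (ρ x) : ℝ) : ℂ) * u x)) x)
    (hlim : Tendsto (fun x ↦ ‖u x‖) atTop (𝓝 1)) (hlim₁ : Tendsto (fun x ↦ ‖u₁ x‖) atTop (𝓝 |ω|))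
    {x : ℝ} (hx : 7 * M ≤ ρ x) :
    (ω ^ 2 - sepPotential M a ω m Λ (ρ x)) * ‖u x‖ ^ 2 + ‖u₁ x‖ ^ 2 ≤ 2 * ω ^ 2 := by
  set φ : ℝ → ℝ := fun y ↦ ω ^ 2 - sepPotential M a ω m Λ (ρ y) with hφ
  set φ' : ℝ → ℝ := fun y ↦
    -(deriv (sepPotential M a ω m Λ) (ρ y) * (delta M a (ρ y) / (ρ y ^ 2 + a ^ 2))) with hφ'
  set E : ℝ → ℝ := fun y ↦ φ y * ‖u y‖ ^ 2 + ‖u₁ y‖ ^ 2 with hE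
  have hderiv : ∀ y, HasDerivAt E (φ' y * ‖u y‖ ^ 2) y := by
    intro y
    have h1 := Literature.Analysis.ODE.hasDerivAt_soninEnergy (φ := φ) (φ' := φ' y) (hu y).1
      (by simpa only [hφ, neg_mul] using (hu y).2) (hρ.hasDerivAt_omega_sq_sub_sepPotential hMa ω m Λ y)
    exact h1
  -- `E` is monotone on `[x, ∞)`
  have hmono : MonotoneOn E (Ici x) := by
    refine monotoneOn_of_hasDerivWithinAt_nonneg (convex_Ici x)
      (fun y _ ↦ (hderiv y).continuousAt.continuousWithinAt)
      (fun y _ ↦ (hderiv y).hasDerivWithinAt) fun y hy ↦ ?_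
    have hy' : x ≤ y := interior_subset (s := Ici x) hy
    have h7 : 7 * M ≤ ρ y := hx.trans ((hρ.strictMono hMa).monotone hy')
    have hV : deriv (sepPotential M a ω m Λ) (ρ y) < 0 :=
      deriv_sepPotential_neg_of_seven_mul_le hMa hadm h7
    have hρ' : 0 < delta M a (ρ y) / (ρ y ^ 2 + a ^ 2) := hρ.deriv_pos hMa y
    have : 0 ≤ φ' y := by
      simp only [hφ']
      nlinarith [mul_neg_of_neg_of_pos hV hρ']
    exact mul_nonneg this (sq_nonneg _)
  -- `E → 2ω²`
  have hlimE : Tendsto E atTop (𝓝 (2 * ω ^ 2)) := by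
    have hφlim : Tendsto φ atTop (𝓝 (ω ^ 2)) := by
      have h := (tendsto_const_nhds (x := ω ^ 2)).sub (hρ.tendsto_sepPotential_atTop hMa hadm)
      rw [sub_zero] at h
      exact h
    have h := (hφlim.mul (hlim.pow 2)).add (hlim₁.pow 2)
    have e : ω ^ 2 * 1 ^ 2 + |ω| ^ 2 = 2 * ω ^ 2 := by rw [one_pow, mul_one, sq_abs]; ring
    rw [e] at h
    exact h
  refine ge_of_tendsto hlimE ?_
  filter_upwards [eventually_ge_atTop x] with y hy
  exact hmono self_mem_Ici hy hy

/-- `‖u′ x‖ ≤ √2·|ω|` at every `x` with `ρ x ≥ 7M` where the coefficient is non-negative,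
`ω² − V(ρ x) ≥ 0`. [cite: DafermosRodnianskiShlapentokhrothman2014, Prop. 8.4.1 (proof)] -/
theorem carter_far_norm_deriv_le (hρ : IsTortoiseRadius M a ρ) (hMa : IsSubextremal M a)
    (hadm : IsAdmissibleTriple a ω m Λ)
    (hu : ∀ x, HasDerivAt u (u₁ x) x ∧
      HasDerivAt u₁ (-(((ω ^ 2 - sepPotential M a ω m Λ (ρ x) : ℝ) : ℂ) * u x)) x)
    (hlim : Tendsto (fun x ↦ ‖u x‖) atTop (𝓝 1)) (hlim₁ : Tendsto (fun x ↦ ‖u₁ x‖) atTop (𝓝 |ω|))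
    {x : ℝ} (hx : 7 * M ≤ ρ x) (hφ : 0 ≤ ω ^ 2 - sepPotential M a ω m Λ (ρ x)) :
    ‖u₁ x‖ ≤ Real.sqrt 2 * |ω| := by
  have hE := carter_farEnergy_le hρ hMa hadm hu hlim hlim₁ hx
  have h1 : ‖u₁ x‖ ^ 2 ≤ 2 * ω ^ 2 := by nlinarith [mul_nonneg hφ (sq_nonneg ‖u x‖)]
  have h2 : (Real.sqrt 2 * |ω|) ^ 2 = 2 * ω ^ 2 := by
    rw [mul_pow, Real.sq_sqrt (by norm_num : (0 : ℝ) ≤ 2), sq_abs]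
  rw [← h2] at h1
  exact (pow_le_pow_iff_left₀ (norm_nonneg _) (by positivity) two_ne_zero).1 h1

/-- `‖u x‖ ≤ 2` for `ρ x ≥ R_far = max(7M, √(12Λ)/|ω|, 1/(Mω²))` (`ω ≠ 0`): there `ω² − V ≥ ω²/2`, so
`(ω²/2)‖u‖² ≤ 2ω²`. [cite: DafermosRodnianskiShlapentokhrothman2014, Prop. 8.4.1 (proof)] -/
theorem carter_far_norm_le_two (hρ : IsTortoiseRadius M a ρ) (hMa : IsSubextremal M a) (hω : ω ≠ 0)
    (hadm : IsAdmissibleTriple a ω m Λ)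
    (hu : ∀ x, HasDerivAt u (u₁ x) x ∧
      HasDerivAt u₁ (-(((ω ^ 2 - sepPotential M a ω m Λ (ρ x) : ℝ) : ℂ) * u x)) x)
    (hlim : Tendsto (fun x ↦ ‖u x‖) atTop (𝓝 1)) (hlim₁ : Tendsto (fun x ↦ ‖u₁ x‖) atTop (𝓝 |ω|))
    {x : ℝ} (hx : max (7 * M) (max (Real.sqrt (12 * Λ) / |ω|) (1 / (M * ω ^ 2))) ≤ ρ x) :
    ‖u x‖ ≤ 2 := by
  have h7 : 7 * M ≤ ρ x := le_of_max_le_left hx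
  have hE := carter_farEnergy_le hρ hMa hadm hu hlim hlim₁ h7
  have hφ := half_sq_le_omega_sq_sub_sepPotential hMa hω hadm hx
  have hω2 : 0 < ω ^ 2 := by positivity
  have h1 : ω ^ 2 / 2 * ‖u x‖ ^ 2 ≤ 2 * ω ^ 2 := by
    nlinarith [mul_le_mul_of_nonneg_right hφ (sq_nonneg ‖u x‖), sq_nonneg ‖u₁ x‖]
  have h2 : ‖u x‖ ^ 2 ≤ 2 ^ 2 := by nlinarith
  exact (pow_le_pow_iff_left₀ (norm_nonneg _) (by norm_num) two_ne_zero).1 h2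

/-- **Linear growth inward in the far zone**: for `x ≤ y` with `ρ x ≥ 7M` and `ω² − V(ρ s) ≥ 0` for all
`s ∈ [x, y]`, `‖u x‖ ≤ ‖u y‖ + √2|ω|·(y − x)` (mean value inequality with `‖u′‖ ≤ √2|ω|`). [folklore] -/
theorem carter_far_norm_le_linear (hρ : IsTortoiseRadius M a ρ) (hMa : IsSubextremal M a)
    (hadm : IsAdmissibleTriple a ω m Λ)
    (hu : ∀ x, HasDerivAt u (u₁ x) x ∧
      HasDerivAt u₁ (-(((ω ^ 2 - sepPotential M a ω m Λ (ρ x) : ℝ) : ℂ) * u x)) x)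
    (hlim : Tendsto (fun x ↦ ‖u x‖) atTop (𝓝 1)) (hlim₁ : Tendsto (fun x ↦ ‖u₁ x‖) atTop (𝓝 |ω|))
    {x y : ℝ} (hxy : x ≤ y) (hx : 7 * M ≤ ρ x)
    (hφ : ∀ s ∈ Icc x y, 0 ≤ ω ^ 2 - sepPotential M a ω m Λ (ρ s)) :
    ‖u x‖ ≤ ‖u y‖ + Real.sqrt 2 * |ω| * (y - x) := by
  have hbound : ∀ s ∈ Icc x y, ‖u₁ s‖ ≤ Real.sqrt 2 * |ω| := fun s hs ↦
    carter_far_norm_deriv_le hρ hMa hadm hu hlim hlim₁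
      (hx.trans ((hρ.strictMono hMa).monotone hs.1)) (hφ s hs)
  have hmv : ‖u y - u x‖ ≤ Real.sqrt 2 * |ω| * (y - x) :=
    norm_image_sub_le_of_norm_deriv_le_segment' (fun s _ ↦ (hu s).1.hasDerivWithinAt)
      (fun s hs ↦ hbound s (Ico_subset_Icc_self hs)) y (right_mem_Icc.2 hxy)
  have : ‖u x‖ ≤ ‖u y‖ + ‖u y - u x‖ := by
    calc ‖u x‖ = ‖u y - (u y - u x)‖ := by rw [sub_sub_cancel]
      _ ≤ ‖u y‖ + ‖u y - u x‖ := norm_sub_le _ _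
  linarith

/-- **Far envelope**: `‖u x‖ ≤ 2 + 2|ω|·R_far`, `R_far = max(7M, √(12Λ)/|ω|, 1/(Mω²))`, at every `x` with
`ρ x ≥ 7M` such that the coefficient `ω² − V ∘ ρ` is non-negative on `[x, ∞)` (in the applications: every
`x ≥ 7M` to the right of the single barrier). Linear growth over the tortoise length `≤ (7/5)(R_far − ρ x)`
from the radius `R_far` where `‖u‖ ≤ 2`; no transition collar is used. [cite: DafermosRodnianskiShlapentokhrothman2014, Prop. 8.4.1 (proof)] -/
theorem carter_far_norm_le (hρ : IsTortoiseRadius M a ρ) (hMa : IsSubextremal M a) (hω : ω ≠ 0)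
    (hadm : IsAdmissibleTriple a ω m Λ)
    (hu : ∀ x, HasDerivAt u (u₁ x) x ∧
      HasDerivAt u₁ (-(((ω ^ 2 - sepPotential M a ω m Λ (ρ x) : ℝ) : ℂ) * u x)) x)
    (hlim : Tendsto (fun x ↦ ‖u x‖) atTop (𝓝 1)) (hlim₁ : Tendsto (fun x ↦ ‖u₁ x‖) atTop (𝓝 |ω|))
    {x : ℝ} (hx : 7 * M ≤ ρ x) (hφ : ∀ s, x ≤ s → 0 ≤ ω ^ 2 - sepPotential M a ω m Λ (ρ s)) :
    ‖u x‖ ≤ 2 + 2 * |ω| * max (7 * M) (max (Real.sqrt (12 * Λ) / |ω|) (1 / (M * ω ^ 2))) := by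
  set R := max (7 * M) (max (Real.sqrt (12 * Λ) / |ω|) (1 / (M * ω ^ 2))) with hR
  have hM : 0 < M := hMa.pos
  have hR7 : 7 * M ≤ R := le_max_left _ _
  have hR0 : 0 ≤ R := by linarith
  have hω0 : 0 ≤ |ω| := abs_nonneg ω
  rcases le_or_gt R (ρ x) with hfar | hnear
  · have h2 := carter_far_norm_le_two hρ hMa hω hadm hu hlim hlim₁ (x := x) hfar
    nlinarith [mul_nonneg hω0 hR0]
  · -- `y` with `ρ y = R`, `x < y`
    have hRp : rPlus M a < R := (hρ.rPlus_lt x).trans hnear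
    obtain ⟨y, hy⟩ := hρ.exists_apply_eq hRp
    have hxy : x ≤ y := by
      rw [← hρ.le_iff_le hMa, hy]; exact hnear.le
    have hlin := carter_far_norm_le_linear hρ hMa hadm hu hlim hlim₁ hxy hx (fun s hs ↦ hφ s hs.1)
    have h2 := carter_far_norm_le_two hρ hMa hω hadm hu hlim hlim₁ (x := y) (by rw [hy])
    have hlen : y - x ≤ 7 / 5 * (ρ y - ρ x) := hρ.sub_le_mul_sub hMa hxy hx
    have hlen' : y - x ≤ 7 / 5 * R := by
      rw [hy] at hlen
      have : 0 ≤ ρ x := le_of_lt ((rPlus_pos hM a).trans (hρ.rPlus_lt x))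
      linarith
    have hs2 : Real.sqrt 2 ≤ 10 / 7 := by
      rw [Real.sqrt_le_left (by norm_num)]; norm_num
    calc ‖u x‖ ≤ ‖u y‖ + Real.sqrt 2 * |ω| * (y - x) := hlin
      _ ≤ 2 + Real.sqrt 2 * |ω| * (7 / 5 * R) := by
          gcongr
      _ ≤ 2 + 10 / 7 * |ω| * (7 / 5 * R) := by gcongr
      _ = 2 + 2 * |ω| * R := by ring

end Far

end Kerr

end Literature.Geometry.Lorentzian

end
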